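import Literature.Analysis.PDE.WeightedPoincareBoundary
import Literature.Analysis.PDE.KornIdentity
import HarnessLib

/-!
# Weighted estimates for vector fields: the Killing operator near a spherical boundary
# (Chruściel–Delay 2003, Appendix D: Lemma D.1, Prop. D.2, Cor. D.5, flat ball)

The `Y`-part of the boundary coercivity of the adjoint linearised constraint operator
(Chruściel–Delay 2003, proof of Thm. 5.9, (5.12): `‖Y‖ ≲ ‖x² S(Y)‖` in exponentially weighted
`L²` near `∂M`), in the flat model: `E` a finite-dimensional real inner product space with an
orthonormal basis `b`, a vector field given by its components `Y_j ∈ C¹_c(E)`, the **Killing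
operator** (symmetrised gradient) `S(Y)ᵢⱼ = ½(∂ᵢYⱼ + ∂ⱼYᵢ)` and `div Y = Σᵢ ∂ᵢYᵢ`.

* `integral_symGrad_pairing_eq` — **Lemma D.1**: for `V ∈ C¹`,
  `∫ [S(Y) + ½(div Y)δ](Y, V) = −∫ (½ ∂V(Y,Y) + ¼ (div V)|Y|²)`;
* `integral_exp_symGrad_pairing_eq` — **Prop. D.2**: for `u ∈ C¹`,
  `∫ e^{2u}[S(Y) + ½(div Y)δ](Y, V) = −∫ e^{2u}(½ ∂V(Y,Y) + ¼ (div V)|Y|² + ½⟨∂u,V⟩|Y|² + ⟨∂u,Y⟩⟨V,Y⟩)`,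
  and its localisation to weights `C¹` near `supp Y` (`…_of_subset`);
* `integral_shell_weight_normSq_le_symGrad` — **Cor. D.5 / (5.12) on the ball `B(z₀, ρ)`**: for
  `s > 0`, `t ∈ ℝ`, `ε ∈ (0, s/2)` there is `x₁ > 0` such that for `Y` supported in the shell
  `{ρ − x₁ < |z − z₀| < ρ}` (`x = ρ − |z − z₀|`),
  `(s/2 − ε)² ∫ e^{−2s/x} x^{2t−4} |Y|² ≤ ∫ e^{−2s/x} x^{2t} |S(Y) + ½(div Y)δ|²`
  (Prop. D.2 with `V = ∇x/x² = ∇(−1/x)`, `u = −s/x + t log x`, the radial calculus of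
  `WeightedPoincareBoundary.lean`, and `ab ≤ (δ/2)a² + b²/(2δ)`).

Everything is proved; no statements of `Prop` type are introduced.

## References

* P. T. Chruściel, E. Delay, Mém. Soc. Math. Fr. 94 (2003), Appendix D (Lemma D.1, Prop. D.2,
  Cor. D.5) and (5.12). [ChruscielDelay2003]
-/

noncomputable section

open Set Function Filter MeasureTheory Metric
open scoped Topology ContDiff RealInnerProductSpace

namespace Literature.Analysis.PDE

namespace WeightedPoincare

variable {E : Type*} [NormedAddCommGroup E] [InnerProductSpace ℝ E] [FiniteDimensional ℝ E]
  [MeasurableSpace E] [BorelSpace E] {ι : Type*} [Fintype ι] [DecidableEq ι]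
  (b : OrthonormalBasis ι ℝ E)

/-! ### Lemma D.1: one integration by parts for vector fields -/

/-- **Chruściel–Delay 2003, Lemma D.1** (flat): for `Y_j ∈ C¹_c`, `V_j ∈ C¹`,
`∫ Σᵢⱼ [½(∂ᵢYⱼ + ∂ⱼYᵢ) + ½(div Y)δᵢⱼ] Yᵢ Vⱼ = −∫ (½ Σᵢⱼ ∂ᵢVⱼ YᵢYⱼ + ¼ (div V) Σⱼ Yⱼ²)`
(the `δ`-term written as `Σₖ ∂ₖYₖ/2`).
[cite: ChruscielDelay2003, Appendix D, Lemma D.1] -/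
theorem integral_symGrad_pairing_eq {Y V : ι → E → ℝ} (hY : ∀ j, ContDiff ℝ 1 (Y j))
    (hYc : ∀ j, HasCompactSupport (Y j)) (hV : ∀ j, ContDiff ℝ 1 (V j)) :
    ∫ x, ∑ i, ∑ j, ((fderiv ℝ (Y j) x (b i) + fderiv ℝ (Y i) x (b j)) / 2 +
        (if i = j then ∑ k, fderiv ℝ (Y k) x (b k) / 2 else 0)) * Y i x * V j x =
      -∫ x, ((∑ i, ∑ j, fderiv ℝ (V j) x (b i) * Y i x * Y j x) / 2 +
        (∑ i, fderiv ℝ (V i) x (b i)) * (∑ j, Y j x ^ 2) / 4) := by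
  have hY0 : ∀ j, Continuous (Y j) := fun j ↦ (hY j).continuous
  have hV0 : ∀ j, Continuous (V j) := fun j ↦ (hV j).continuous
  have hdY : ∀ j e, Continuous fun x ↦ fderiv ℝ (Y j) x e := fun j e ↦
    ((hY j).continuous_fderiv one_ne_zero).clm_apply continuous_const
  have hdV : ∀ j e, Continuous fun x ↦ fderiv ℝ (V j) x e := fun j e ↦
    ((hV j).continuous_fderiv one_ne_zero).clm_apply continuous_const
  -- integrability of every product carrying a factor `Y j`
  have hI : ∀ (j) {F : E → ℝ}, Continuous F → Integrable fun x ↦ Y j x * F x := fun j F hF ↦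
    ((hY0 j).mul hF).integrable_of_hasCompactSupport (hYc j).mul_right
  -- (1) `∫ ∂ᵢYⱼ Yᵢ Vⱼ = -∫ Yⱼ (∂ᵢYᵢ Vⱼ + Yᵢ ∂ᵢVⱼ)`
  have h1 : ∀ i j, ∫ x, fderiv ℝ (Y j) x (b i) * (Y i x * V j x) =
      -∫ x, Y j x * (fderiv ℝ (Y i) x (b i) * V j x + Y i x * fderiv ℝ (V j) x (b i)) := by
    intro i j
    have hg : ContDiff ℝ 1 fun x ↦ Y i x * V j x := (hY i).mul (hV j)
    rw [Korn.integral_fderiv_mul_eq_neg (hY j) (hYc j) hg (b i)]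
    congr 1
    refine integral_congr_ae (Eventually.of_forall fun x ↦ ?_)
    simp only
    rw [fderiv_fun_mul ((hY i).differentiable one_ne_zero x) ((hV j).differentiable one_ne_zero x)]
    simp only [_root_.add_apply, FunLike.coe_smul, Pi.smul_apply, smul_eq_mul]
    ring
  -- (2) `∫ ∂ⱼYᵢ Yᵢ Vⱼ = -½ ∫ Yᵢ² ∂ⱼVⱼ` (from `∫ ∂ⱼYᵢ (Yᵢ Vⱼ) = -∫ Yᵢ(∂ⱼYᵢ Vⱼ + Yᵢ∂ⱼVⱼ)`)
  have h2 : ∀ i j, ∫ x, fderiv ℝ (Y i) x (b j) * (Y i x * V j x) =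
      -(1 / 2) * ∫ x, Y i x * (Y i x * fderiv ℝ (V j) x (b j)) := by
    intro i j
    have h := h1 j i
    -- `h : ∫ ∂ⱼYᵢ (Yⱼ? ...)` -- careful: `h1 j i` reads `∫ ∂ⱼ(Y i) (Y j V i)`; we need `i i j`
    have hg : ContDiff ℝ 1 fun x ↦ Y i x * V j x := (hY i).mul (hV j)
    have h' := Korn.integral_fderiv_mul_eq_neg (hY i) (hYc i) hg (b j)
    have hsplit : ∫ x, Y i x * fderiv ℝ (fun x ↦ Y i x * V j x) x (b j) =
        (∫ x, fderiv ℝ (Y i) x (b j) * (Y i x * V j x)) +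
          ∫ x, Y i x * (Y i x * fderiv ℝ (V j) x (b j)) := by
      rw [← integral_add]
      · refine integral_congr_ae (Eventually.of_forall fun x ↦ ?_)
        simp only
        rw [fderiv_fun_mul ((hY i).differentiable one_ne_zero x)
          ((hV j).differentiable one_ne_zero x)]
        simp only [_root_.add_apply, FunLike.coe_smul, Pi.smul_apply, smul_eq_mul]
        ring
      · have : (fun x ↦ fderiv ℝ (Y i) x (b j) * (Y i x * V j x)) =
            fun x ↦ Y i x * (fderiv ℝ (Y i) x (b j) * V j x) := by funext x; ring
        rw [this]; exact hI i ((hdY i _).mul (hV0 j))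
      · exact hI i ((hY0 i).mul (hdV j _))
    rw [hsplit] at h'
    linarith
  -- atomic integrals
  set J : ι → ι → ℝ := fun i j ↦ ∫ x, Y j x * (fderiv ℝ (Y i) x (b i) * V j x) with hJ
  set Hs : ι → ι → ℝ := fun i j ↦ ∫ x, Y j x * (Y i x * fderiv ℝ (V j) x (b i)) with hHs
  set D : ι → ι → ℝ := fun i j ↦ ∫ x, Y i x * (Y i x * fderiv ℝ (V j) x (b j)) with hD
  have hJi : ∀ i j, Integrable fun x ↦ Y j x * (fderiv ℝ (Y i) x (b i) * V j x) :=
    fun i j ↦ hI j ((hdY i _).mul (hV0 j))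
  have hHsi : ∀ i j, Integrable fun x ↦ Y j x * (Y i x * fderiv ℝ (V j) x (b i)) :=
    fun i j ↦ hI j ((hY0 i).mul (hdV j _))
  have hDi : ∀ i j, Integrable fun x ↦ Y i x * (Y i x * fderiv ℝ (V j) x (b j)) :=
    fun i j ↦ hI i ((hY0 i).mul (hdV j _))
  -- `∫ ∂ᵢYⱼ Yᵢ Vⱼ = -(J i j + Hs i j)`
  have hA : ∀ i j, ∫ x, fderiv ℝ (Y j) x (b i) * (Y i x * V j x) = -(J i j + Hs i j) := by
    intro i j
    rw [h1 i j, hJ, hHs]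
    simp only
    rw [← integral_add (hJi i j) (hHsi i j)]
    congr 1
    refine integral_congr_ae (Eventually.of_forall fun x ↦ ?_)
    ring
  -- the three pieces of the left-hand side
  have hAi : ∀ i j, Integrable fun x ↦ fderiv ℝ (Y j) x (b i) * (Y i x * V j x) := fun i j ↦ by
    have : (fun x ↦ fderiv ℝ (Y j) x (b i) * (Y i x * V j x)) =
        fun x ↦ Y i x * (fderiv ℝ (Y j) x (b i) * V j x) := by funext x; ring
    rw [this]; exact hI i ((hdY j _).mul (hV0 j))
  have hBi : ∀ i j, Integrable fun x ↦ fderiv ℝ (Y i) x (b j) * (Y i x * V j x) := fun i j ↦ by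
    have : (fun x ↦ fderiv ℝ (Y i) x (b j) * (Y i x * V j x)) =
        fun x ↦ Y i x * (fderiv ℝ (Y i) x (b j) * V j x) := by funext x; ring
    rw [this]; exact hI i ((hdY i _).mul (hV0 j))
  have hLHS : ∫ x, ∑ i, ∑ j, ((fderiv ℝ (Y j) x (b i) + fderiv ℝ (Y i) x (b j)) / 2 +
      (if i = j then ∑ k, fderiv ℝ (Y k) x (b k) / 2 else 0)) * Y i x * V j x =
      (1 / 2) * (∑ i, ∑ j, -(J i j + Hs i j)) + (1 / 2) * (∑ i, ∑ j, (-(1 / 2) * D i j)) +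
        (1 / 2) * ∑ k, ∑ j, J k j := by
    have hsplit : (fun x ↦ ∑ i, ∑ j, ((fderiv ℝ (Y j) x (b i) + fderiv ℝ (Y i) x (b j)) / 2 +
        (if i = j then ∑ k, fderiv ℝ (Y k) x (b k) / 2 else 0)) * Y i x * V j x) =
        fun x ↦ (1 / 2) * (∑ i, ∑ j, fderiv ℝ (Y j) x (b i) * (Y i x * V j x)) +
          (1 / 2) * (∑ i, ∑ j, fderiv ℝ (Y i) x (b j) * (Y i x * V j x)) +
          (1 / 2) * ∑ k, ∑ j, Y j x * (fderiv ℝ (Y k) x (b k) * V j x) := by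
      funext x
      have hdiag : ∑ i, ∑ j, (if i = j then ∑ k, fderiv ℝ (Y k) x (b k) / 2 else 0) *
          Y i x * V j x = (1 / 2) * ∑ k, ∑ j, Y j x * (fderiv ℝ (Y k) x (b k) * V j x) := by
        simp only [ite_mul, zero_mul, Finset.sum_ite_eq, Finset.mem_univ, if_true]
        simp only [Finset.mul_sum, Finset.sum_mul]
        rw [Finset.sum_comm]
        exact Finset.sum_congr rfl fun k _ ↦ Finset.sum_congr rfl fun j _ ↦ by ring
      rw [← hdiag]
      simp only [Finset.mul_sum, ← Finset.sum_add_distrib]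
      exact Finset.sum_congr rfl fun i _ ↦ Finset.sum_congr rfl fun j _ ↦ by ring
    rw [hsplit]
    have hI1 : Integrable fun x ↦ (1 / 2 : ℝ) * ∑ i, ∑ j, fderiv ℝ (Y j) x (b i) * (Y i x * V j x) :=
      (integrable_finsetSum _ fun i _ ↦ integrable_finsetSum _ fun j _ ↦ hAi i j).const_mul _
    have hI2 : Integrable fun x ↦ (1 / 2 : ℝ) * ∑ i, ∑ j, fderiv ℝ (Y i) x (b j) * (Y i x * V j x) :=
      (integrable_finsetSum _ fun i _ ↦ integrable_finsetSum _ fun j _ ↦ hBi i j).const_mul _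
    have hI3 : Integrable fun x ↦ (1 / 2 : ℝ) * ∑ k, ∑ j, Y j x * (fderiv ℝ (Y k) x (b k) * V j x) :=
      (integrable_finsetSum _ fun k _ ↦ integrable_finsetSum _ fun j _ ↦ hJi k j).const_mul _
    rw [integral_add (f := fun x ↦ (1 / 2 : ℝ) * (∑ i, ∑ j, fderiv ℝ (Y j) x (b i) * (Y i x * V j x)) +
        (1 / 2 : ℝ) * (∑ i, ∑ j, fderiv ℝ (Y i) x (b j) * (Y i x * V j x)))
        (g := fun x ↦ (1 / 2 : ℝ) * ∑ k, ∑ j, Y j x * (fderiv ℝ (Y k) x (b k) * V j x))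
        (hI1.add hI2) hI3,
      integral_add hI1 hI2, integral_const_mul, integral_const_mul, integral_const_mul,
      integral_finsetSum _ fun i _ ↦ integrable_finsetSum _ fun j _ ↦ hAi i j,
      integral_finsetSum _ fun i _ ↦ integrable_finsetSum _ fun j _ ↦ hBi i j,
      integral_finsetSum _ fun k _ ↦ integrable_finsetSum _ fun j _ ↦ hJi k j]
    simp_rw [integral_finsetSum _ fun j _ ↦ hAi _ j, integral_finsetSum _ fun j _ ↦ hBi _ j,
      integral_finsetSum _ fun j _ ↦ hJi _ j, hA, h2]
    simp only [hJ, hHs, hD]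
  have hRHS : ∫ x, ((∑ i, ∑ j, fderiv ℝ (V j) x (b i) * Y i x * Y j x) / 2 +
      (∑ i, fderiv ℝ (V i) x (b i)) * (∑ j, Y j x ^ 2) / 4) =
      (1 / 2) * (∑ i, ∑ j, Hs i j) + (1 / 4) * ∑ i, ∑ j, D j i := by
    have hsplit : (fun x ↦ (∑ i, ∑ j, fderiv ℝ (V j) x (b i) * Y i x * Y j x) / 2 +
        (∑ i, fderiv ℝ (V i) x (b i)) * (∑ j, Y j x ^ 2) / 4) =
        fun x ↦ (1 / 2) * (∑ i, ∑ j, Y j x * (Y i x * fderiv ℝ (V j) x (b i))) +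
          (1 / 4) * ∑ i, ∑ j, Y j x * (Y j x * fderiv ℝ (V i) x (b i)) := by
      funext x
      rw [Finset.sum_mul_sum]
      have e1 : ∑ i, ∑ j, fderiv ℝ (V j) x (b i) * Y i x * Y j x =
          ∑ i, ∑ j, Y j x * (Y i x * fderiv ℝ (V j) x (b i)) :=
        Finset.sum_congr rfl fun i _ ↦ Finset.sum_congr rfl fun j _ ↦ by ring
      have e2 : ∑ i, ∑ j, fderiv ℝ (V i) x (b i) * Y j x ^ 2 =
          ∑ i, ∑ j, Y j x * (Y j x * fderiv ℝ (V i) x (b i)) :=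
        Finset.sum_congr rfl fun i _ ↦ Finset.sum_congr rfl fun j _ ↦ by ring
      rw [e1, e2]
      ring
    rw [hsplit]
    have hI1 : Integrable fun x ↦ (1 / 2 : ℝ) * ∑ i, ∑ j, Y j x * (Y i x * fderiv ℝ (V j) x (b i)) :=
      (integrable_finsetSum _ fun i _ ↦ integrable_finsetSum _ fun j _ ↦ hHsi i j).const_mul _
    have hI2 : Integrable fun x ↦ (1 / 4 : ℝ) * ∑ i, ∑ j, Y j x * (Y j x * fderiv ℝ (V i) x (b i)) :=
      (integrable_finsetSum _ fun i _ ↦ integrable_finsetSum _ fun j _ ↦ hDi j i).const_mul _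
    rw [integral_add hI1 hI2, integral_const_mul, integral_const_mul,
      integral_finsetSum _ fun i _ ↦ integrable_finsetSum _ fun j _ ↦ hHsi i j,
      integral_finsetSum _ fun i _ ↦ integrable_finsetSum _ fun j _ ↦ hDi j i]
    simp_rw [integral_finsetSum _ fun j _ ↦ hHsi _ j, integral_finsetSum _ fun j _ ↦ hDi j _]
    simp only [hHs, hD]
  rw [hLHS, hRHS]
  have hDcomm : ∑ i, ∑ j, D j i = ∑ i, ∑ j, D i j := Finset.sum_comm
  rw [hDcomm]
  simp only [Finset.sum_add_distrib, Finset.sum_neg_distrib, ← Finset.mul_sum]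
  ring

/-! ### Prop. D.2: the weighted identity -/

omit [MeasurableSpace E] [BorelSpace E] in
omit b in
/-- Expansion of the `δᵢⱼ`-term of the pairing `[a + (Σₖ cₖ) δ](y, v)` into a double sum.
[folklore] -/
theorem sum_pairing_expand (a : ι → ι → ℝ) (c y v : ι → ℝ) :
    ∑ i, ∑ j, (a i j + if i = j then ∑ k, c k else 0) * y i * v j =
      ∑ i, ∑ j, (a i j * y i * v j + c j * y i * v i) := by
  have h : ∀ i, ∑ j, (a i j + if i = j then ∑ k, c k else 0) * y i * v j =
      (∑ j, a i j * y i * v j) + (∑ k, c k) * y i * v i := by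
    intro i
    simp only [add_mul, Finset.sum_add_distrib, ite_mul, zero_mul, Finset.sum_ite_eq,
      Finset.mem_univ, if_true]
  simp only [h, Finset.sum_mul, ← Finset.sum_add_distrib]

/-- **Chruściel–Delay 2003, Prop. D.2** (flat): for `Y_j ∈ C¹_c`, `V_j, u ∈ C¹`,
`∫ e^{2u}[S(Y) + ½(div Y)δ](Y,V) = −∫ e^{2u}(½∂V(Y,Y) + ¼ div V |Y|² + ½⟨∂u,V⟩|Y|² + ⟨∂u,Y⟩⟨V,Y⟩)`,
with the right-hand side written as a double sum (the last term symmetrised in `i, j`).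
[cite: ChruscielDelay2003, Appendix D, Prop. D.2] -/
theorem integral_exp_symGrad_pairing_eq {Y V : ι → E → ℝ} {u : E → ℝ}
    (hY : ∀ j, ContDiff ℝ 1 (Y j)) (hYc : ∀ j, HasCompactSupport (Y j))
    (hV : ∀ j, ContDiff ℝ 1 (V j)) (hu : ContDiff ℝ 1 u) :
    ∫ x, Real.exp (2 * u x) * ∑ i, ∑ j, ((fderiv ℝ (Y j) x (b i) + fderiv ℝ (Y i) x (b j)) / 2 +
        (if i = j then ∑ k, fderiv ℝ (Y k) x (b k) / 2 else 0)) * Y i x * V j x =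
      -∫ x, Real.exp (2 * u x) * ∑ i, ∑ j,
        (fderiv ℝ (V j) x (b i) * Y i x * Y j x / 2 + fderiv ℝ (V j) x (b j) * Y i x ^ 2 / 4 +
          fderiv ℝ u x (b j) * V j x * Y i x ^ 2 / 2 +
          (fderiv ℝ u x (b i) * Y i x * Y j x * V j x +
            fderiv ℝ u x (b j) * Y j x * Y i x * V i x) / 2) := by
  -- Lemma D.1 for `e^{u} Y`
  set Yt : ι → E → ℝ := fun j x ↦ Real.exp (u x) * Y j x with hYt
  have hYt1 : ∀ j, ContDiff ℝ 1 (Yt j) := fun j ↦ hu.exp.mul (hY j)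
  have hYtc : ∀ j, HasCompactSupport (Yt j) := fun j ↦ (hYc j).mul_left
  have hD1 := integral_symGrad_pairing_eq b hYt1 hYtc hV
  have hY0 : ∀ j, Continuous (Y j) := fun j ↦ (hY j).continuous
  have hV0 : ∀ j, Continuous (V j) := fun j ↦ (hV j).continuous
  have hdY : ∀ j e, Continuous fun x ↦ fderiv ℝ (Y j) x e := fun j e ↦
    ((hY j).continuous_fderiv one_ne_zero).clm_apply continuous_const
  have hdV : ∀ j e, Continuous fun x ↦ fderiv ℝ (V j) x e := fun j e ↦
    ((hV j).continuous_fderiv one_ne_zero).clm_apply continuous_const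
  have hdu : ∀ e, Continuous fun x ↦ fderiv ℝ u x e := fun e ↦
    (hu.continuous_fderiv one_ne_zero).clm_apply continuous_const
  have heu : Continuous fun x ↦ Real.exp (2 * u x) := (continuous_const.mul hu.continuous).rexp
  have hdYt : ∀ j x e, fderiv ℝ (Yt j) x e =
      Real.exp (u x) * (Y j x * fderiv ℝ u x e + fderiv ℝ (Y j) x e) := fun j x e ↦
    fderiv_exp_mul_apply ((hY j).differentiable one_ne_zero x) (hu.differentiable one_ne_zero x) e
  have hexp2 : ∀ x, Real.exp (2 * u x) = Real.exp (u x) * Real.exp (u x) := fun x ↦ by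
    rw [← Real.exp_add]; ring_nf
  -- the integrands
  set Mn : E → ℝ := fun x ↦ Real.exp (2 * u x) * ∑ i, ∑ j,
    ((fderiv ℝ (Y j) x (b i) + fderiv ℝ (Y i) x (b j)) / 2 +
      (if i = j then ∑ k, fderiv ℝ (Y k) x (b k) / 2 else 0)) * Y i x * V j x with hMn
  set Ex : E → ℝ := fun x ↦ Real.exp (2 * u x) * ∑ i, ∑ j,
    (fderiv ℝ u x (b j) * V j x * Y i x ^ 2 / 2 +
      (fderiv ℝ u x (b i) * Y i x * Y j x * V j x +
        fderiv ℝ u x (b j) * Y j x * Y i x * V i x) / 2) with hEx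
  set Rh : E → ℝ := fun x ↦ Real.exp (2 * u x) * ∑ i, ∑ j,
    (fderiv ℝ (V j) x (b i) * Y i x * Y j x / 2 + fderiv ℝ (V j) x (b j) * Y i x ^ 2 / 4)
    with hRh
  -- the left-hand side of Lemma D.1 for `e^{u}Y` is `Mn + Ex`
  have hL : (fun x ↦ ∑ i, ∑ j, ((fderiv ℝ (Yt j) x (b i) + fderiv ℝ (Yt i) x (b j)) / 2 +
      (if i = j then ∑ k, fderiv ℝ (Yt k) x (b k) / 2 else 0)) * Yt i x * V j x) =
      fun x ↦ Mn x + Ex x := by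
    funext x
    rw [hMn, hEx]
    simp only
    rw [sum_pairing_expand, sum_pairing_expand, hexp2 x, Finset.mul_sum, Finset.mul_sum,
      ← Finset.sum_add_distrib]
    refine Finset.sum_congr rfl fun i _ ↦ ?_
    rw [Finset.mul_sum, Finset.mul_sum, ← Finset.sum_add_distrib]
    refine Finset.sum_congr rfl fun j _ ↦ ?_
    rw [hdYt j x (b i), hdYt i x (b j), hdYt j x (b j)]
    simp only [hYt]
    ring
  -- the right-hand side of Lemma D.1 for `e^{u}Y` is `Rh`
  have hR : (fun x ↦ (∑ i, ∑ j, fderiv ℝ (V j) x (b i) * Yt i x * Yt j x) / 2 +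
      (∑ i, fderiv ℝ (V i) x (b i)) * (∑ j, Yt j x ^ 2) / 4) = Rh := by
    funext x
    rw [hRh]
    simp only
    rw [hexp2 x, Finset.sum_mul_sum]
    have e1 : (∑ i, ∑ j, fderiv ℝ (V j) x (b i) * Yt i x * Yt j x) / 2 =
        ∑ i, ∑ j, Real.exp (u x) * Real.exp (u x) * (fderiv ℝ (V j) x (b i) * Y i x * Y j x / 2) := by
      rw [Finset.sum_div]
      refine Finset.sum_congr rfl fun i _ ↦ ?_
      rw [Finset.sum_div]
      refine Finset.sum_congr rfl fun j _ ↦ ?_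
      simp only [hYt]; ring
    have e2 : (∑ i, ∑ j, fderiv ℝ (V i) x (b i) * Yt j x ^ 2) / 4 =
        ∑ i, ∑ j, Real.exp (u x) * Real.exp (u x) * (fderiv ℝ (V j) x (b j) * Y i x ^ 2 / 4) := by
      rw [Finset.sum_comm, Finset.sum_div]
      refine Finset.sum_congr rfl fun i _ ↦ ?_
      rw [Finset.sum_div]
      refine Finset.sum_congr rfl fun j _ ↦ ?_
      simp only [hYt]; ring
    rw [e1, e2, ← Finset.sum_add_distrib, Finset.mul_sum]
    refine Finset.sum_congr rfl fun i _ ↦ ?_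
    rw [← Finset.sum_add_distrib, Finset.mul_sum]
    refine Finset.sum_congr rfl fun j _ ↦ ?_
    ring
  rw [hL, hR] at hD1
  -- integrability and splitting
  have hIY : ∀ (j) {F : E → ℝ}, Continuous F → Integrable fun x ↦ Y j x * F x := fun j F hF ↦
    ((hY0 j).mul hF).integrable_of_hasCompactSupport (hYc j).mul_right
  have hMni : Integrable Mn := by
    have h : Mn = fun x ↦ ∑ i, ∑ j, Y i x * (Real.exp (2 * u x) *
        (((fderiv ℝ (Y j) x (b i) + fderiv ℝ (Y i) x (b j)) / 2 +
          (if i = j then ∑ k, fderiv ℝ (Y k) x (b k) / 2 else 0)) * V j x)) := by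
      funext x; simp only [hMn, Finset.mul_sum]
      exact Finset.sum_congr rfl fun i _ ↦ Finset.sum_congr rfl fun j _ ↦ by ring
    rw [h]
    refine integrable_finsetSum _ fun i _ ↦ integrable_finsetSum _ fun j _ ↦ hIY i ?_
    refine heu.mul ((Continuous.add ?_ ?_).mul (hV0 j))
    · exact ((hdY j _).add (hdY i _)).div_const _
    · exact continuous_if_const _ (fun _ ↦ continuous_finsetSum _ fun k _ ↦ (hdY k _).div_const _)
        (fun _ ↦ continuous_const)
  have hExi : Integrable Ex := by
    have h : Ex = fun x ↦ ∑ i, ∑ j, Y i x * (Real.exp (2 * u x) *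
        (fderiv ℝ u x (b j) * V j x * Y i x / 2 +
          (fderiv ℝ u x (b i) * Y j x * V j x + fderiv ℝ u x (b j) * Y j x * V i x) / 2)) := by
      funext x; simp only [hEx, Finset.mul_sum]
      exact Finset.sum_congr rfl fun i _ ↦ Finset.sum_congr rfl fun j _ ↦ by ring
    rw [h]
    refine integrable_finsetSum _ fun i _ ↦ integrable_finsetSum _ fun j _ ↦ hIY i ?_
    exact heu.mul (((((hdu _).mul (hV0 j)).mul (hY0 i)).div_const _).add
      (((((hdu _).mul (hY0 j)).mul (hV0 j)).add (((hdu _).mul (hY0 j)).mul (hV0 i))).div_const _))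
  have hRhi : Integrable Rh := by
    have h : Rh = fun x ↦ ∑ i, ∑ j, Y i x * (Real.exp (2 * u x) *
        (fderiv ℝ (V j) x (b i) * Y j x / 2 + fderiv ℝ (V j) x (b j) * Y i x / 4)) := by
      funext x; simp only [hRh, Finset.mul_sum]
      exact Finset.sum_congr rfl fun i _ ↦ Finset.sum_congr rfl fun j _ ↦ by ring
    rw [h]
    refine integrable_finsetSum _ fun i _ ↦ integrable_finsetSum _ fun j _ ↦ hIY i ?_
    exact heu.mul ((((hdV j _).mul (hY0 j)).div_const _).add (((hdV j _).mul (hY0 i)).div_const _))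
  rw [integral_add hMni hExi] at hD1
  have hgoal : ∫ x, Mn x = -∫ x, (Rh x + Ex x) := by
    rw [integral_add hRhi hExi]; linarith
  have hsum : (fun x ↦ Rh x + Ex x) = fun x ↦ Real.exp (2 * u x) * ∑ i, ∑ j,
      (fderiv ℝ (V j) x (b i) * Y i x * Y j x / 2 + fderiv ℝ (V j) x (b j) * Y i x ^ 2 / 4 +
        fderiv ℝ u x (b j) * V j x * Y i x ^ 2 / 2 +
        (fderiv ℝ u x (b i) * Y i x * Y j x * V j x +
          fderiv ℝ u x (b j) * Y j x * Y i x * V i x) / 2) := by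
    funext x
    simp only [hRh, hEx, ← mul_add, ← Finset.sum_add_distrib]
    congr 1
    exact Finset.sum_congr rfl fun i _ ↦ Finset.sum_congr rfl fun j _ ↦ by ring
  rw [hsum] at hgoal
  exact hgoal

/-! ### Localisation of Prop. D.2 -/

/-- **Prop. D.2 localised**: `V_j`, `u` need only be `C¹` on an open set containing the supports
of the `Y_j`. [cite: ChruscielDelay2003, Appendix D, Prop. D.2] -/
theorem integral_exp_symGrad_pairing_eq_of_subset {Y V : ι → E → ℝ} {u : E → ℝ} {U : Set E}
    (hU : IsOpen U) (hY : ∀ j, ContDiff ℝ 1 (Y j)) (hYc : ∀ j, HasCompactSupport (Y j))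
    (hYU : ∀ j, tsupport (Y j) ⊆ U) (hV : ∀ j, ContDiffOn ℝ 1 (V j) U) (hu : ContDiffOn ℝ 1 u U) :
    ∫ x, Real.exp (2 * u x) * ∑ i, ∑ j, ((fderiv ℝ (Y j) x (b i) + fderiv ℝ (Y i) x (b j)) / 2 +
        (if i = j then ∑ k, fderiv ℝ (Y k) x (b k) / 2 else 0)) * Y i x * V j x =
      -∫ x, Real.exp (2 * u x) * ∑ i, ∑ j,
        (fderiv ℝ (V j) x (b i) * Y i x * Y j x / 2 + fderiv ℝ (V j) x (b j) * Y i x ^ 2 / 4 +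
          fderiv ℝ u x (b j) * V j x * Y i x ^ 2 / 2 +
          (fderiv ℝ u x (b i) * Y i x * Y j x * V j x +
            fderiv ℝ u x (b j) * Y j x * Y i x * V i x) / 2) := by
  classical
  -- cut-off equal to one near the union of the supports
  set K : Set E := ⋃ j, tsupport (Y j) with hK
  have hKc : IsCompact K := isCompact_iUnion fun j ↦ hYc j
  have hKU : K ⊆ U := iUnion_subset hYU
  obtain ⟨χ, hχ, -, hχU, hχ1⟩ := exists_cutoff_eq_one_nhdsSet hKc hU hKU
  obtain ⟨O', hO'o, hKO', hO'1⟩ := mem_nhdsSet_iff_exists.1 hχ1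
  set O : Set E := O' ∩ U with hO_def
  have hO : IsOpen O := hO'o.inter hU
  have hKO : K ⊆ O := fun x hx ↦ ⟨hKO' hx, hKU hx⟩
  have hχO : ∀ x ∈ O, χ x = 1 := fun x hx ↦ hO'1 hx.1
  have hχ1' : ContDiff ℝ 1 χ := hχ.of_le (by norm_cast)
  set Vt : ι → E → ℝ := fun j z ↦ χ z * V j z with hVt
  set ut : E → ℝ := fun z ↦ χ z * u z with hut
  have hVt1 : ∀ j, ContDiff ℝ 1 (Vt j) := fun j ↦ contDiff_cutoff_mul hU hχ1' hχU (hV j)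
  have hut1 : ContDiff ℝ 1 ut := contDiff_cutoff_mul hU hχ1' hχU hu
  have hmain := integral_exp_symGrad_pairing_eq b hY hYc hVt1 hut1
  -- agreement on `O`
  have hVO : ∀ j, ∀ x ∈ O, Vt j =ᶠ[𝓝 x] V j := fun j x hx ↦ by
    filter_upwards [hO.mem_nhds hx] with y hy
    simp only [hVt, hχO y hy, one_mul]
  have huO : ∀ x ∈ O, ut =ᶠ[𝓝 x] u := fun x hx ↦ by
    filter_upwards [hO.mem_nhds hx] with y hy
    simp only [hut, hχO y hy, one_mul]
  have hV0 : ∀ j, ∀ x ∈ O, Vt j x = V j x := fun j x hx ↦ (hVO j x hx).self_of_nhds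
  have hu0 : ∀ x ∈ O, ut x = u x := fun x hx ↦ (huO x hx).self_of_nhds
  have hV1 : ∀ j, ∀ x ∈ O, ∀ e, fderiv ℝ (Vt j) x e = fderiv ℝ (V j) x e := fun j x hx e ↦ by
    rw [(hVO j x hx).fderiv_eq]
  have hu1 : ∀ x ∈ O, ∀ e, fderiv ℝ ut x e = fderiv ℝ u x e := fun x hx e ↦ by
    rw [(huO x hx).fderiv_eq]
  -- off `K` every `Y i` vanishes
  have hYK : ∀ x, x ∉ K → ∀ i, Y i x = 0 := fun x hx i ↦
    image_eq_zero_of_notMem_tsupport fun h ↦ hx (mem_iUnion.2 ⟨i, h⟩)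
  have hL : (fun x ↦ Real.exp (2 * ut x) * ∑ i, ∑ j, ((fderiv ℝ (Y j) x (b i) +
      fderiv ℝ (Y i) x (b j)) / 2 + (if i = j then ∑ k, fderiv ℝ (Y k) x (b k) / 2 else 0)) *
        Y i x * Vt j x) =
      fun x ↦ Real.exp (2 * u x) * ∑ i, ∑ j, ((fderiv ℝ (Y j) x (b i) +
      fderiv ℝ (Y i) x (b j)) / 2 + (if i = j then ∑ k, fderiv ℝ (Y k) x (b k) / 2 else 0)) *
        Y i x * V j x := by
    funext x
    by_cases hx : x ∈ K
    · have hxO := hKO hx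
      simp only [hu0 x hxO, hV0 _ x hxO]
    · simp only [hYK x hx, mul_zero, zero_mul, Finset.sum_const_zero]
  have hR : (fun x ↦ Real.exp (2 * ut x) * ∑ i, ∑ j,
      (fderiv ℝ (Vt j) x (b i) * Y i x * Y j x / 2 + fderiv ℝ (Vt j) x (b j) * Y i x ^ 2 / 4 +
        fderiv ℝ ut x (b j) * Vt j x * Y i x ^ 2 / 2 +
        (fderiv ℝ ut x (b i) * Y i x * Y j x * Vt j x +
          fderiv ℝ ut x (b j) * Y j x * Y i x * Vt i x) / 2)) =
      fun x ↦ Real.exp (2 * u x) * ∑ i, ∑ j,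
      (fderiv ℝ (V j) x (b i) * Y i x * Y j x / 2 + fderiv ℝ (V j) x (b j) * Y i x ^ 2 / 4 +
        fderiv ℝ u x (b j) * V j x * Y i x ^ 2 / 2 +
        (fderiv ℝ u x (b i) * Y i x * Y j x * V j x +
          fderiv ℝ u x (b j) * Y j x * Y i x * V i x) / 2) := by
    funext x
    by_cases hx : x ∈ K
    · have hxO := hKO hx
      simp only [hu0 x hxO, hV0 _ x hxO, hu1 x hxO, hV1 _ x hxO]
    · simp only [hYK x hx, mul_zero, zero_mul, Finset.sum_const_zero, zero_div, add_zero,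
        ne_eq, OfNat.ofNat_ne_zero, not_false_eq_true, zero_pow]
  rw [hL, hR] at hmain
  exact hmain

/-! ### Radial fields: derivatives of `F(|z|)` and the pairing terms -/

section Radial

open Literature.Analysis.FluidPDE

omit [FiniteDimensional ℝ E] [MeasurableSpace E] [BorelSpace E] [DecidableEq ι] in
omit b in
/-- **First and second derivatives of a radial function** off the origin:
`∂ₐF(|z|) = (F'(|z|)/|z|)⟨z,a⟩` and
`∂_c∂ₐF(|z|) = (F''(|z|)/|z|² − F'(|z|)/|z|³)⟨z,a⟩⟨z,c⟩ + (F'(|z|)/|z|)⟨a,c⟩`. [folklore] -/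
theorem radial_fderiv {F F₁ F₂ : ℝ → ℝ} {R : Set ℝ} (hR : IsOpen R) (hR0 : ∀ r ∈ R, 0 < r)
    (hF : ∀ r ∈ R, HasDerivAt F (F₁ r) r) (hF₁ : ∀ r ∈ R, HasDerivAt F₁ (F₂ r) r) {z : E}
    (hz : ‖z‖ ∈ R) (a c : E) :
    fderiv ℝ (fun w : E ↦ F ‖w‖) z a = F₁ ‖z‖ / ‖z‖ * ⟪z, a⟫ ∧
      fderiv ℝ (fun y : E ↦ fderiv ℝ (fun w : E ↦ F ‖w‖) y a) z c =
        (F₂ ‖z‖ / ‖z‖ ^ 2 - F₁ ‖z‖ / ‖z‖ ^ 3) * ⟪z, a⟫ * ⟪z, c⟫ + F₁ ‖z‖ / ‖z‖ * ⟪a, c⟫ := by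
  set g : ℝ → ℝ := fun σ ↦ F (Real.sqrt σ) with hg
  set g₁ : ℝ → ℝ := fun σ ↦ F₁ (Real.sqrt σ) / (2 * Real.sqrt σ) with hg₁
  set U : Set ℝ := Ioi 0 ∩ Real.sqrt ⁻¹' R with hU
  have hUo : IsOpen U := isOpen_Ioi.inter (hR.preimage Real.continuous_sqrt)
  have hfun : (fun w : E ↦ F ‖w‖) = fun w ↦ g (‖w‖ ^ 2) := by
    funext w; simp [hg, Real.sqrt_sq (norm_nonneg w)]
  have hgd : ∀ σ ∈ U, HasDerivAt g (g₁ σ) σ := by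
    rintro σ ⟨hσ0, hσR⟩
    have h := (hF _ hσR).comp σ (Real.hasDerivAt_sqrt (ne_of_gt hσ0))
    refine h.congr_deriv ?_
    simp only [hg₁]
    ring
  have hz0 : 0 < ‖z‖ := hR0 _ hz
  have hσ : ‖z‖ ^ 2 ∈ U := ⟨mem_Ioi.2 (by positivity), by simpa [Real.sqrt_sq (norm_nonneg z)] using hz⟩
  have hsq : Real.sqrt (‖z‖ ^ 2) = ‖z‖ := Real.sqrt_sq (norm_nonneg z)
  set σ₀ : ℝ := ‖z‖ ^ 2 with hσ₀
  have hσ₀0 : 0 < σ₀ := by positivity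
  set g₂ : ℝ := F₂ ‖z‖ / (4 * σ₀) - F₁ ‖z‖ / (4 * σ₀ * ‖z‖) with hg₂
  have hg₁d : HasDerivAt g₁ g₂ σ₀ := by
    have h1 : HasDerivAt (fun σ ↦ F₁ (Real.sqrt σ)) (F₂ ‖z‖ * (1 / (2 * ‖z‖))) σ₀ := by
      have h := (hF₁ _ hz)
      rw [← hsq] at h
      have h' := h.comp σ₀ (Real.hasDerivAt_sqrt (ne_of_gt hσ₀0))
      rw [hsq] at h'
      exact h'
    have h2 : HasDerivAt (fun σ ↦ (2 * Real.sqrt σ)⁻¹) (-(2 * (1 / (2 * ‖z‖))) / (2 * ‖z‖) ^ 2) σ₀ := by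
      have h := ((Real.hasDerivAt_sqrt (ne_of_gt hσ₀0)).const_mul 2).inv (by rw [hsq]; positivity)
      rw [hsq] at h
      exact h
    have h := h1.mul h2
    have hfun₁ : g₁ = fun σ ↦ F₁ (Real.sqrt σ) * (2 * Real.sqrt σ)⁻¹ := by
      funext σ; simp only [hg₁, div_eq_mul_inv]
    rw [hfun₁]
    refine h.congr_deriv ?_
    rw [hsq, hg₂, hσ₀]
    field_simp
    ring
  have hd1 : fderiv ℝ (fun w : E ↦ g (‖w‖ ^ 2)) z a = 2 * g₁ σ₀ * ⟪z, a⟫ :=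
    fderiv_comp_norm_sq_apply (hgd _ hσ) a
  have hd2 : fderiv ℝ (fun w : E ↦ fderiv ℝ (fun w : E ↦ g (‖w‖ ^ 2)) w a) z c =
      4 * g₂ * ⟪z, a⟫ * ⟪z, c⟫ + 2 * g₁ σ₀ * ⟪a, c⟫ :=
    fderiv_fderiv_comp_norm_sq_apply hUo hgd hσ hg₁d a c
  have hg₁v : g₁ σ₀ = F₁ ‖z‖ / (2 * ‖z‖) := by
    show F₁ (Real.sqrt σ₀) / (2 * Real.sqrt σ₀) = _
    rw [hσ₀, hsq]
  rw [hfun]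
  refine ⟨?_, ?_⟩
  · rw [hd1, hg₁v]
    field_simp
  · rw [hd2, hg₁v]
    simp only [hg₂, hσ₀]
    field_simp

omit [FiniteDimensional ℝ E] [MeasurableSpace E] [BorelSpace E] in
/-- `⟪bᵢ, bⱼ⟫ = δᵢⱼ` for an orthonormal basis. [folklore] -/
theorem inner_basis_eq_ite (i j : ι) : ⟪b i, b j⟫ = if i = j then (1 : ℝ) else 0 :=
  orthonormal_iff_ite.1 b.orthonormal i j

omit [FiniteDimensional ℝ E] [MeasurableSpace E] [BorelSpace E] [DecidableEq ι] in
/-- Bessel/Parseval bound for the component pairing: `(Σⱼ ⟨w, bⱼ⟩ Yⱼ)² ≤ |w|² Σⱼ Yⱼ²`.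
[folklore] -/
theorem sq_sum_inner_mul_le (w : E) (Yc : ι → ℝ) :
    (∑ j, ⟪w, b j⟫ * Yc j) ^ 2 ≤ ‖w‖ ^ 2 * ∑ j, Yc j ^ 2 := by
  have h := Finset.sum_mul_sq_le_sq_mul_sq Finset.univ (fun j ↦ ⟪w, b j⟫) Yc
  rwa [b.sum_sq_inner_left] at h

end Radial

/-! ### The pairing terms for `V = ∇(−1/x)`, `u = −s/x + t log x` on the shell -/

section ShellField

/-- The potential `Π(r) = −1/(ρ − r) = −1/x` of the field `V = ∇Π = ∇x/x²`.
[cite: ChruscielDelay2003, Appendix D, proof of Cor. D.5] -/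
def bdryPot (ρ : ℝ) (r : ℝ) : ℝ := -(ρ - r)⁻¹

/-- `Π' = −1/x²`. [cite: ChruscielDelay2003, Appendix D, proof of Cor. D.5] -/
def bdryPot₁ (ρ : ℝ) (r : ℝ) : ℝ := -((ρ - r) ^ 2)⁻¹

/-- `Π'' = −2/x³`. [cite: ChruscielDelay2003, Appendix D, proof of Cor. D.5] -/
def bdryPot₂ (ρ : ℝ) (r : ℝ) : ℝ := -2 * ((ρ - r) ^ 3)⁻¹

/-- `dΠ/dr = Π₁`. [folklore] -/
theorem hasDerivAt_bdryPot {ρ r : ℝ} (hr : r < ρ) : HasDerivAt (bdryPot ρ) (bdryPot₁ ρ r) r := by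
  have hx : ρ - r ≠ 0 := by linarith
  have h1 : HasDerivAt (fun r ↦ ρ - r) (-1) r := by simpa using (hasDerivAt_id r).const_sub ρ
  have h := (h1.inv hx).neg
  refine h.congr_deriv ?_
  simp only [bdryPot₁]
  field_simp

/-- `dΠ₁/dr = Π₂`. [folklore] -/
theorem hasDerivAt_bdryPot₁ {ρ r : ℝ} (hr : r < ρ) : HasDerivAt (bdryPot₁ ρ) (bdryPot₂ ρ r) r := by
  have hx : ρ - r ≠ 0 := by linarith
  have h1 : HasDerivAt (fun r ↦ ρ - r) (-1) r := by simpa using (hasDerivAt_id r).const_sub ρ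
  have h2 : HasDerivAt (fun r ↦ (ρ - r) ^ 2) (((2 : ℕ) : ℝ) * (ρ - r) ^ (2 - 1) * (-1)) r :=
    h1.pow 2
  have h := (h2.inv (pow_ne_zero 2 hx)).neg
  refine h.congr_deriv ?_
  simp only [bdryPot₂, Nat.cast_ofNat]
  field_simp
  ring

/-- `Π` is `C^∞` below `ρ`. [folklore] -/
theorem contDiffAt_bdryPot {ρ r : ℝ} (hr : r < ρ) {n : ℕ∞ω} : ContDiffAt ℝ n (bdryPot ρ) r := by
  have hx : ρ - r ≠ 0 := by linarith
  exact ((contDiffAt_const.sub contDiffAt_id).inv hx).neg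

/-- `Π₁` is `C^∞` below `ρ`. [folklore] -/
theorem contDiffAt_bdryPot₁ {ρ r : ℝ} (hr : r < ρ) {n : ℕ∞ω} : ContDiffAt ℝ n (bdryPot₁ ρ) r := by
  have hx : (ρ - r) ^ 2 ≠ 0 := pow_ne_zero 2 (by linarith)
  exact (((contDiffAt_const.sub contDiffAt_id).pow 2).inv hx).neg

/-- **The coefficient of `⟨n, Y⟩²` is nonnegative** near the boundary for `s > 0`:
`½(Π₂/1 − Π₁/r) + u₁Π₁ ≥ 0`, i.e. `s/x⁴ + (t − 1)/x³ + 1/(2 r x²) ≥ 0` when `x(|t| + 1) ≤ s`.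
[cite: ChruscielDelay2003, Appendix D, proof of Cor. D.5] -/
theorem shell_alpha_nonneg {s t x r : ℝ} (hx : 0 < x) (hr : 0 < r) (hxs : x * (|t| + 1) ≤ s) :
    0 ≤ (1 / 2) * (-2 * (x ^ 3)⁻¹ - -(x ^ 2)⁻¹ / r) + -(s / x ^ 2 + t / x) * -(x ^ 2)⁻¹ := by
  have key : (1 / 2) * (-2 * (x ^ 3)⁻¹ - -(x ^ 2)⁻¹ / r) + -(s / x ^ 2 + t / x) * -(x ^ 2)⁻¹ =
      (s + (t - 1) * x + x ^ 2 / (2 * r)) / x ^ 4 := by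
    field_simp
    ring
  rw [key]
  refine div_nonneg ?_ (by positivity)
  have h1 : -(|t| + 1) * x ≤ (t - 1) * x := by
    have := neg_abs_le t
    nlinarith
  have h2 : 0 ≤ x ^ 2 / (2 * r) := by positivity
  nlinarith

/-- **The coefficient of `|Y|²` is `≥ (s/2 − ε)/x⁴`** near the boundary:
`½Π₁/r + ¼(Π₂ + mΠ₁/r) + ½u₁Π₁ ≥ (s/2 − ε)/x⁴` when
`x ((|t| + 1)/2 + (|m| + 2)/4) ≤ ε`, `0 < x ≤ ρ/2 ≤ r` (`m = n − 1`).
[cite: ChruscielDelay2003, Appendix D, proof of Cor. D.5] -/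
theorem shell_beta_lower_bound {s t x r ρ ε m : ℝ} (hx : 0 < x) (hx1 : x ≤ ρ / 2)
    (hr : ρ / 2 ≤ r) (hxε : x * ((|t| + 1) / 2 + (|m| + 2) / 4) ≤ ε) :
    (s / 2 - ε) / x ^ 4 ≤
      (1 / 2) * (-(x ^ 2)⁻¹) / r + (1 / 4) * (-2 * (x ^ 3)⁻¹ + m * -(x ^ 2)⁻¹ / r) +
        (1 / 2) * (-(s / x ^ 2 + t / x) * -(x ^ 2)⁻¹) := by
  have hr0 : 0 < r := by linarith
  have hx4 : 0 < x ^ 4 := by positivity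
  rw [div_le_iff₀ hx4]
  have key : ((1 / 2) * (-(x ^ 2)⁻¹) / r + (1 / 4) * (-2 * (x ^ 3)⁻¹ + m * -(x ^ 2)⁻¹ / r) +
      (1 / 2) * (-(s / x ^ 2 + t / x) * -(x ^ 2)⁻¹)) * x ^ 4 =
      s / 2 + (t - 1) / 2 * x - (m + 2) / (4 * r) * x ^ 2 := by
    field_simp
    ring
  rw [key]
  have e1 : -((|t| + 1) / 2 * x) ≤ (t - 1) / 2 * x := by
    have := neg_abs_le t
    nlinarith
  have hxr : x ≤ r := by linarith
  have hx2 : x ^ 2 / (4 * r) ≤ x / 4 := by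
    rw [div_le_div_iff₀ (by positivity) (by positivity)]
    nlinarith
  have e2 : (m + 2) / (4 * r) * x ^ 2 ≤ (|m| + 2) / 4 * x := by
    have hm : m + 2 ≤ |m| + 2 := by linarith [le_abs_self m]
    calc (m + 2) / (4 * r) * x ^ 2 = (m + 2) * (x ^ 2 / (4 * r)) := by ring
      _ ≤ (|m| + 2) * (x ^ 2 / (4 * r)) := mul_le_mul_of_nonneg_right hm (by positivity)
      _ ≤ (|m| + 2) * (x / 4) := mul_le_mul_of_nonneg_left hx2 (by positivity)
      _ = (|m| + 2) / 4 * x := by ring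
  nlinarith

omit b in
/-- **The algebra of the pairing terms for radial `V = ∇Π`, `u`**: with `cᵢ = ⟨w, bᵢ⟩`,
`∂ᵢVⱼ = A cᵢcⱼ + B δᵢⱼ`, `Vⱼ = q cⱼ`, `∂ᵢu = p cᵢ`, `W = Σ cⱼYⱼ`, `Q = Σ Yⱼ²`, `R = Σ cⱼ²`:
`Σᵢⱼ (∂ᵢVⱼYᵢYⱼ/2 + ∂ⱼVⱼYᵢ²/4 + ∂ⱼu VⱼYᵢ²/2 + (∂ᵢuYᵢYⱼVⱼ + ∂ⱼuYⱼYᵢVᵢ)/2)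
 = (A/2 + pq) W² + (B/2 + (AR + nB)/4 + pqR/2) Q`. [folklore] -/
theorem radial_pairing_sum_eq (A B p q : ℝ) (c Yc : ι → ℝ) :
    ∑ i, ∑ j, ((A * c i * c j + B * (if i = j then 1 else 0)) * Yc i * Yc j / 2 +
        (A * c j * c j + B) * Yc i ^ 2 / 4 +
        p * c j * (q * c j) * Yc i ^ 2 / 2 +
        (p * c i * Yc i * Yc j * (q * c j) + p * c j * Yc j * Yc i * (q * c i)) / 2) =
      (A / 2 + p * q) * (∑ j, c j * Yc j) ^ 2 +
        (B / 2 + (A * (∑ j, c j ^ 2) + Fintype.card ι * B) / 4 + p * q * (∑ j, c j ^ 2) / 2) *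
          ∑ j, Yc j ^ 2 := by
  have L1 : ∑ i, ∑ j, (A * c i * c j + B * (if i = j then 1 else 0)) * Yc i * Yc j =
      A * (∑ j, c j * Yc j) ^ 2 + B * ∑ j, Yc j ^ 2 := by
    simp only [add_mul, Finset.sum_add_distrib, mul_ite, mul_one, mul_zero, ite_mul, zero_mul,
      Finset.sum_ite_eq, Finset.mem_univ, if_true]
    rw [sq, Finset.sum_mul_sum, Finset.mul_sum, Finset.mul_sum]
    congr 1
    · exact Finset.sum_congr rfl fun i _ ↦ by
        rw [Finset.mul_sum]
        exact Finset.sum_congr rfl fun j _ ↦ by ring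
    · exact Finset.sum_congr rfl fun i _ ↦ by ring
  have L2 : ∑ i, ∑ j, (A * c j * c j + B) * Yc i ^ 2 =
      (A * (∑ j, c j ^ 2) + Fintype.card ι * B) * ∑ j, Yc j ^ 2 := by
    rw [Finset.mul_sum]
    refine Finset.sum_congr rfl fun i _ ↦ ?_
    rw [← Finset.sum_mul, Finset.sum_add_distrib, Finset.sum_const, Finset.card_univ, nsmul_eq_mul,
      Finset.mul_sum]
    congr 1
    congr 1
    exact Finset.sum_congr rfl fun j _ ↦ by ring
  have L3 : ∑ i, ∑ j, p * c j * (q * c j) * Yc i ^ 2 = p * q * (∑ j, c j ^ 2) * ∑ j, Yc j ^ 2 := by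
    rw [Finset.mul_sum]
    refine Finset.sum_congr rfl fun i _ ↦ ?_
    rw [Finset.mul_sum, Finset.sum_mul]
    exact Finset.sum_congr rfl fun j _ ↦ by ring
  have L4a : ∑ i, ∑ j, p * c i * Yc i * Yc j * (q * c j) = (p * q) * (∑ j, c j * Yc j) ^ 2 := by
    rw [sq, Finset.sum_mul_sum, Finset.mul_sum]
    refine Finset.sum_congr rfl fun i _ ↦ ?_
    rw [Finset.mul_sum]
    refine Finset.sum_congr rfl fun j _ ↦ ?_
    ring
  have L4b : ∑ i, ∑ j, p * c j * Yc j * Yc i * (q * c i) = (p * q) * (∑ j, c j * Yc j) ^ 2 := by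
    rw [Finset.sum_comm, ← L4a]
  -- assemble
  have hsplit : ∀ i j, ((A * c i * c j + B * (if i = j then 1 else 0)) * Yc i * Yc j / 2 +
      (A * c j * c j + B) * Yc i ^ 2 / 4 +
      p * c j * (q * c j) * Yc i ^ 2 / 2 +
      (p * c i * Yc i * Yc j * (q * c j) + p * c j * Yc j * Yc i * (q * c i)) / 2) =
      (1 / 2) * ((A * c i * c j + B * (if i = j then 1 else 0)) * Yc i * Yc j) +
      (1 / 4) * ((A * c j * c j + B) * Yc i ^ 2) +
      (1 / 2) * (p * c j * (q * c j) * Yc i ^ 2) +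
      (1 / 2) * (p * c i * Yc i * Yc j * (q * c j)) +
      (1 / 2) * (p * c j * Yc j * Yc i * (q * c i)) := by
    intro i j; ring
  rw [Finset.sum_congr rfl fun i _ ↦ Finset.sum_congr rfl fun j _ ↦ hsplit i j]
  simp only [Finset.sum_add_distrib, ← Finset.mul_sum]
  rw [L1, L2, L3, L4a, L4b]
  ring

end ShellField

/-! ### Cor. D.5 / (5.12) on the ball -/

section Assembly

omit [MeasurableSpace E] [BorelSpace E] in
omit b in
/-- `P ≤ δa²/2 + c²/(2δ)` when `P² ≤ a² c²`. [folklore] -/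
theorem le_of_sq_le_mul {P a2 c2 δ : ℝ} (hδ : 0 < δ) (ha : 0 ≤ a2) (hc : 0 ≤ c2)
    (h : P ^ 2 ≤ a2 * c2) : P ≤ δ * a2 / 2 + c2 / (2 * δ) := by
  set y : ℝ := δ * a2 / 2 + c2 / (2 * δ) with hy
  have hy0 : 0 ≤ y := by positivity
  have hkey : a2 * c2 ≤ y ^ 2 := by
    have h4 : y ^ 2 - a2 * c2 = (δ * a2 / 2 - c2 / (2 * δ)) ^ 2 := by
      rw [hy]; field_simp; ring
    nlinarith [sq_nonneg (δ * a2 / 2 - c2 / (2 * δ))]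
  exact (le_abs_self P).trans (abs_le_of_sq_le_sq (h.trans hkey) hy0)

omit [MeasurableSpace E] [BorelSpace E] [DecidableEq ι] in
omit b in
/-- Discrete Cauchy–Schwarz for a bilinear pairing: `(Σᵢⱼ Mᵢⱼ yᵢ vⱼ)² ≤ (Σᵢⱼ Mᵢⱼ²)(Σ yᵢ²)(Σ vⱼ²)`.
[folklore] -/
theorem sq_sum_sum_mul_mul_le (M : ι → ι → ℝ) (y v : ι → ℝ) :
    (∑ i, ∑ j, M i j * y i * v j) ^ 2 ≤ (∑ i, ∑ j, M i j ^ 2) * (∑ i, y i ^ 2) * ∑ j, v j ^ 2 := by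
  have h1 : (∑ i, y i * ∑ j, M i j * v j) ^ 2 ≤ (∑ i, y i ^ 2) * ∑ i, (∑ j, M i j * v j) ^ 2 :=
    Finset.sum_mul_sq_le_sq_mul_sq _ _ _
  have h2 : ∀ i, (∑ j, M i j * v j) ^ 2 ≤ (∑ j, M i j ^ 2) * ∑ j, v j ^ 2 := fun i ↦
    Finset.sum_mul_sq_le_sq_mul_sq _ _ _
  have h3 : ∑ i, (∑ j, M i j * v j) ^ 2 ≤ (∑ i, ∑ j, M i j ^ 2) * ∑ j, v j ^ 2 := by
    rw [Finset.sum_mul]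
    exact Finset.sum_le_sum fun i _ ↦ h2 i
  have heq : ∑ i, ∑ j, M i j * y i * v j = ∑ i, y i * ∑ j, M i j * v j := by
    refine Finset.sum_congr rfl fun i _ ↦ ?_
    rw [Finset.mul_sum]
    exact Finset.sum_congr rfl fun j _ ↦ by ring
  rw [heq]
  calc (∑ i, y i * ∑ j, M i j * v j) ^ 2 ≤ (∑ i, y i ^ 2) * ∑ i, (∑ j, M i j * v j) ^ 2 := h1
    _ ≤ (∑ i, y i ^ 2) * ((∑ i, ∑ j, M i j ^ 2) * ∑ j, v j ^ 2) :=
        mul_le_mul_of_nonneg_left h3 (Finset.sum_nonneg fun i _ ↦ sq_nonneg _)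
    _ = _ := by ring

/-- Integrability of `g · f` for `g` continuous vanishing off a compact `K ⊆ U`, `U` open, and
`f` continuous on `U`. [folklore] -/
theorem integrable_mul_of_eq_zero_off {g f : E → ℝ} {K U : Set E} (hK : IsCompact K) (hU : IsOpen U)
    (hKU : K ⊆ U) (hg : Continuous g) (hgK : ∀ x, x ∉ K → g x = 0) (hf : ContinuousOn f U) :
    Integrable fun z ↦ g z * f z := by
  have hgc : HasCompactSupport g := HasCompactSupport.intro hK hgK
  have htg : tsupport g ⊆ U := by
    refine (closure_minimal (fun x hx ↦ ?_) hK.isClosed).trans hKU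
    by_contra h
    exact hx (hgK x h)
  exact (continuous_mul_of_tsupport_subset hU hg htg hf).integrable_of_hasCompactSupport
    hgc.mul_right
set_option maxHeartbeats 400000 in -- buildfix (bf3-g26): 160k/180k FAIL, 200k PASS at accept time; line-neutral budget line
/-- **Chruściel–Delay 2003, Cor. D.5 / (5.12), on the flat ball `B(z₀, ρ)`**: the Killing
operator controls the field near the boundary in exponentially weighted `L²`. For `s > 0`, `t`,
`0 < ε < s/2` there is `x₁ ∈ (0, ρ/2]` such that for all `C¹_c` components `Y_j` supported in the
shell `{ρ − x₁ < |z − z₀| < ρ}` (`x = ρ − |z − z₀|`),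
`(s/2 − ε)² ∫ e^{−2s/x} x^{2t−4} |Y|² ≤ ∫ e^{−2s/x} x^{2t} |S(Y) + ½(div Y)δ|²`.
[cite: ChruscielDelay2003, Appendix D, Cor. D.5] -/
theorem integral_shell_weight_normSq_le_symGrad (z₀ : E) {ρ : ℝ} (hρ : 0 < ρ) {s : ℝ} (hs : 0 < s)
    (t : ℝ) {ε : ℝ} (hε : 0 < ε) (hεs : ε < s / 2) :
    ∃ x₁ : ℝ, 0 < x₁ ∧ x₁ ≤ ρ / 2 ∧ ∀ Y : ι → E → ℝ, (∀ j, ContDiff ℝ 1 (Y j)) →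
      (∀ j, HasCompactSupport (Y j)) →
      (∀ j, tsupport (Y j) ⊆ {z | ρ - x₁ < ‖z - z₀‖ ∧ ‖z - z₀‖ < ρ}) →
      (s / 2 - ε) ^ 2 * ∫ z, Real.exp (-2 * s / (ρ - ‖z - z₀‖)) * (ρ - ‖z - z₀‖) ^ (2 * t - 4) *
          ∑ i, Y i z ^ 2 ≤
        ∫ z, Real.exp (-2 * s / (ρ - ‖z - z₀‖)) * (ρ - ‖z - z₀‖) ^ (2 * t) *
          ∑ i, ∑ j, ((fderiv ℝ (Y j) z (b i) + fderiv ℝ (Y i) z (b j)) / 2 +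
            (if i = j then ∑ k, fderiv ℝ (Y k) z (b k) / 2 else 0)) ^ 2 := by
  -- constants
  set m : ℝ := (Fintype.card ι : ℝ) - 1 with hm
  set C : ℝ := (|t| + 1) / 2 + (|m| + 2) / 4 with hC
  have hC0 : 0 < C := by positivity
  set x₁ : ℝ := min (ρ / 2) (min (s / (|t| + 1)) (ε / C)) with hx₁
  have hx₁pos : 0 < x₁ := lt_min (by positivity) (lt_min (by positivity) (by positivity))
  have hx₁ρ : x₁ ≤ ρ / 2 := min_le_left _ _
  have hx₁s : x₁ * (|t| + 1) ≤ s := by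
    have h : x₁ ≤ s / (|t| + 1) := (min_le_right _ _).trans (min_le_left _ _)
    rwa [le_div_iff₀ (by positivity)] at h
  have hx₁C : x₁ * C ≤ ε := by
    have h : x₁ ≤ ε / C := (min_le_right _ _).trans (min_le_right _ _)
    rwa [le_div_iff₀ hC0] at h
  set δ : ℝ := s / 2 - ε with hδ
  have hδ0 : 0 < δ := by rw [hδ]; linarith
  refine ⟨x₁, hx₁pos, hx₁ρ, fun Y hY hYc hYS ↦ ?_⟩
  -- the shell
  set S : Set E := {z | ρ - x₁ < ‖z - z₀‖ ∧ ‖z - z₀‖ < ρ} with hS_def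
  set r : E → ℝ := fun z ↦ ‖z - z₀‖ with hr
  have hrc : Continuous r := (continuous_id.sub continuous_const).norm
  have hS : IsOpen S := (isOpen_lt continuous_const hrc).inter (isOpen_lt hrc continuous_const)
  have hSr : ∀ z ∈ S, ρ / 2 < r z ∧ r z < ρ := fun z hz ↦ ⟨by simp only [hr]; linarith [hz.1], hz.2⟩
  have hSx : ∀ z ∈ S, 0 < ρ - r z ∧ ρ - r z < x₁ := fun z hz ↦
    ⟨by linarith [(hSr z hz).2], by have := hz.1; simp only [hr]; linarith⟩
  have hSne : ∀ z ∈ S, z - z₀ ≠ 0 := fun z hz ↦ by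
    rw [← norm_pos_iff]; linarith [(hSr z hz).1]
  have hxS : ∀ z ∈ S, ρ - r z ≠ 0 := fun z hz ↦ (hSx z hz).1.ne'
  have hrS : ∀ z ∈ S, r z ≠ 0 := fun z hz ↦ by linarith [(hSr z hz).1]
  -- the union of the supports
  set K : Set E := ⋃ j, tsupport (Y j) with hK
  have hKc : IsCompact K := isCompact_iUnion fun j ↦ hYc j
  have hKS : K ⊆ S := iUnion_subset hYS
  have hYK : ∀ z, z ∉ K → ∀ i, Y i z = 0 := fun z hz i ↦
    image_eq_zero_of_notMem_tsupport fun h ↦ hz (mem_iUnion.2 ⟨i, h⟩)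
  have hdYK : ∀ z, z ∉ K → ∀ i e, fderiv ℝ (Y i) z e = 0 := fun z hz i e ↦
    fderiv_apply_eq_zero_of_notMem_tsupport (fun h ↦ hz (mem_iUnion.2 ⟨i, h⟩)) e
  -- the field `V = ∇Π` and the weight `u`
  set Pz : E → ℝ := fun z ↦ bdryPot ρ ‖z - z₀‖ with hPz
  set V : ι → E → ℝ := fun j z ↦ fderiv ℝ Pz z (b j) with hV
  set uz : E → ℝ := fun z ↦ bdryWeight ρ s t ‖z - z₀‖ with huz
  have hPS : ContDiffOn ℝ 2 Pz S := fun z hz ↦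
    ((contDiffAt_bdryPot (hSr z hz).2).comp z
      ((contDiffAt_id.sub contDiffAt_const).norm ℝ (hSne z hz))).contDiffWithinAt
  have hVS : ∀ j, ContDiffOn ℝ 1 (V j) S := fun j ↦
    (hPS.fderiv_of_isOpen hS (by norm_cast)).clm_apply contDiffOn_const
  have huS : ContDiffOn ℝ 1 uz S := fun z hz ↦
    ((contDiffAt_bdryWeight (hSr z hz).2).comp z
      ((contDiffAt_id.sub contDiffAt_const).norm ℝ (hSne z hz))).contDiffWithinAt
  -- Prop. D.2
  have hD2 := integral_exp_symGrad_pairing_eq_of_subset b hS hY hYc hYS hVS huS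
  -- radial data on `S`
  have hradP : ∀ z ∈ S, ∀ a c : E,
      fderiv ℝ (fun w : E ↦ bdryPot ρ ‖w‖) (z - z₀) a = bdryPot₁ ρ (r z) / r z * ⟪z - z₀, a⟫ ∧
      fderiv ℝ (fun y : E ↦ fderiv ℝ (fun w : E ↦ bdryPot ρ ‖w‖) y a) (z - z₀) c =
        (bdryPot₂ ρ (r z) / r z ^ 2 - bdryPot₁ ρ (r z) / r z ^ 3) * ⟪z - z₀, a⟫ * ⟪z - z₀, c⟫ +
          bdryPot₁ ρ (r z) / r z * ⟪a, c⟫ := fun z hz a c ↦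
    radial_fderiv (F := bdryPot ρ) (R := Ioo (ρ / 2) ρ) isOpen_Ioo (fun r hr ↦ by linarith [hr.1])
      (fun r hr ↦ hasDerivAt_bdryPot hr.2) (fun r hr ↦ hasDerivAt_bdryPot₁ hr.2) (hSr z hz) a c
  have hradU : ∀ z ∈ S, ∀ a : E,
      fderiv ℝ (fun w : E ↦ bdryWeight ρ s t ‖w‖) (z - z₀) a =
        bdryWeight₁ ρ s t (r z) / r z * ⟪z - z₀, a⟫ := fun z hz a ↦
    (radial_fderiv (F := bdryWeight ρ s t) (R := Ioo (ρ / 2) ρ) isOpen_Ioo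
      (fun r hr ↦ by linarith [hr.1]) (fun r hr ↦ hasDerivAt_bdryWeight hr.2)
      (fun r hr ↦ hasDerivAt_bdryWeight₁ hr.2) (hSr z hz) a a).1
  have hVz : ∀ z ∈ S, ∀ j, V j z = bdryPot₁ ρ (r z) / r z * ⟪z - z₀, b j⟫ := fun z hz j ↦ by
    simp only [hV, hPz]
    rw [fderiv_comp_sub (𝕜 := ℝ) (f := fun w : E ↦ bdryPot ρ ‖w‖) (x := z) z₀]
    exact (hradP z hz (b j) (b j)).1
  have hdVz : ∀ z ∈ S, ∀ i j, fderiv ℝ (V j) z (b i) =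
      (bdryPot₂ ρ (r z) / r z ^ 2 - bdryPot₁ ρ (r z) / r z ^ 3) * ⟪z - z₀, b j⟫ * ⟪z - z₀, b i⟫ +
        bdryPot₁ ρ (r z) / r z * ⟪b j, b i⟫ := fun z hz i j ↦ by
    have hfun : V j = fun y ↦ (fun w : E ↦ fderiv ℝ (fun w : E ↦ bdryPot ρ ‖w‖) w (b j)) (y - z₀) := by
      funext y
      simp only [hV, hPz]
      rw [fderiv_comp_sub (𝕜 := ℝ) (f := fun w : E ↦ bdryPot ρ ‖w‖) (x := y) z₀]
    rw [hfun, fderiv_comp_sub (𝕜 := ℝ)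
      (f := fun w : E ↦ fderiv ℝ (fun w : E ↦ bdryPot ρ ‖w‖) w (b j)) (x := z) z₀]
    exact (hradP z hz (b j) (b i)).2
  have hduz : ∀ z ∈ S, ∀ i, fderiv ℝ uz z (b i) = bdryWeight₁ ρ s t (r z) / r z * ⟪z - z₀, b i⟫ :=
    fun z hz i ↦ by
    simp only [huz]
    rw [fderiv_comp_sub (𝕜 := ℝ) (f := fun w : E ↦ bdryWeight ρ s t ‖w‖) (x := z) z₀]
    exact hradU z hz (b i)
  have hparse : ∀ z, ∑ j, ⟪z - z₀, b j⟫ ^ 2 = r z ^ 2 := fun z ↦ b.sum_sq_inner_left (z - z₀)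
  -- abbreviations for the global integrands
  set Qf : E → ℝ := fun z ↦ ∑ i, Y i z ^ 2 with hQf
  set Wf : E → ℝ := fun z ↦ ∑ j, ⟪z - z₀, b j⟫ * Y j z with hWf
  set Mf : ι → ι → E → ℝ := fun i j z ↦ (fderiv ℝ (Y j) z (b i) + fderiv ℝ (Y i) z (b j)) / 2 +
    (if i = j then ∑ k, fderiv ℝ (Y k) z (b k) / 2 else 0) with hMf
  set MF : E → ℝ := fun z ↦ ∑ i, ∑ j, Mf i j z ^ 2 with hMF
  set Pf : E → ℝ := fun z ↦ ∑ i, ∑ j, Mf i j z * Y i z * V j z with hPf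
  set Tf : E → ℝ := fun z ↦ ∑ i, ∑ j,
    (fderiv ℝ (V j) z (b i) * Y i z * Y j z / 2 + fderiv ℝ (V j) z (b j) * Y i z ^ 2 / 4 +
      fderiv ℝ uz z (b j) * V j z * Y i z ^ 2 / 2 +
      (fderiv ℝ uz z (b i) * Y i z * Y j z * V j z + fderiv ℝ uz z (b j) * Y j z * Y i z * V i z) / 2)
    with hTf
  set e2 : E → ℝ := fun z ↦ Real.exp (2 * uz z) with he2
  have hD2' : ∫ z, e2 z * Pf z = -∫ z, e2 z * Tf z := by
    simpa only [hPf, hMf, hTf, he2, mul_assoc] using hD2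
  -- the pairing sum at `z ∈ S` in closed form
  set Ac : E → ℝ := fun z ↦ bdryPot₂ ρ (r z) / r z ^ 2 - bdryPot₁ ρ (r z) / r z ^ 3 with hAc
  set Bc : E → ℝ := fun z ↦ bdryPot₁ ρ (r z) / r z with hBc
  set pc : E → ℝ := fun z ↦ bdryWeight₁ ρ s t (r z) / r z with hpc
  have hTz : ∀ z ∈ S, Tf z = (Ac z / 2 + pc z * Bc z) * Wf z ^ 2 +
      (Bc z / 2 + (Ac z * r z ^ 2 + Fintype.card ι * Bc z) / 4 + pc z * Bc z * r z ^ 2 / 2) * Qf z := by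
    intro z hz
    have hterm : ∀ i j,
        fderiv ℝ (V j) z (b i) * Y i z * Y j z / 2 + fderiv ℝ (V j) z (b j) * Y i z ^ 2 / 4 +
          fderiv ℝ uz z (b j) * V j z * Y i z ^ 2 / 2 +
          (fderiv ℝ uz z (b i) * Y i z * Y j z * V j z +
            fderiv ℝ uz z (b j) * Y j z * Y i z * V i z) / 2 =
        (Ac z * ⟪z - z₀, b i⟫ * ⟪z - z₀, b j⟫ + Bc z * (if i = j then 1 else 0)) * Y i z * Y j z / 2 +
          (Ac z * ⟪z - z₀, b j⟫ * ⟪z - z₀, b j⟫ + Bc z) * Y i z ^ 2 / 4 +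
          pc z * ⟪z - z₀, b j⟫ * (Bc z * ⟪z - z₀, b j⟫) * Y i z ^ 2 / 2 +
          (pc z * ⟪z - z₀, b i⟫ * Y i z * Y j z * (Bc z * ⟪z - z₀, b j⟫) +
            pc z * ⟪z - z₀, b j⟫ * Y j z * Y i z * (Bc z * ⟪z - z₀, b i⟫)) / 2 := by
      intro i j
      rw [hdVz z hz i j, hdVz z hz j j, hduz z hz j, hduz z hz i, hVz z hz j, hVz z hz i,
        inner_basis_eq_ite b j i, inner_basis_eq_ite b j j]
      simp only [hAc, hBc, hpc, if_true]
      by_cases hij : i = j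
      · subst hij; simp only [if_true]; ring
      · simp only [hij, Ne.symm hij, if_false]; ring
    rw [hTf]
    simp only
    rw [Finset.sum_congr rfl fun i _ ↦ Finset.sum_congr rfl fun j _ ↦ hterm i j,
      radial_pairing_sum_eq (Ac z) (Bc z) (pc z) (Bc z) (fun i ↦ ⟪z - z₀, b i⟫) (fun i ↦ Y i z),
      hparse z]
  -- the pointwise lower bound `T ≥ δ Q / x⁴` on `S`
  have hTlow : ∀ z ∈ S, δ / (ρ - r z) ^ 4 * Qf z ≤ Tf z := by
    intro z hz
    obtain ⟨hx, hxlt⟩ := hSx z hz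
    have hr0 : 0 < r z := by linarith [(hSr z hz).1]
    have hxs : (ρ - r z) * (|t| + 1) ≤ s :=
      le_trans (mul_le_mul_of_nonneg_right hxlt.le (by positivity)) hx₁s
    have hxε : (ρ - r z) * ((|t| + 1) / 2 + (|m| + 2) / 4) ≤ ε :=
      le_trans (mul_le_mul_of_nonneg_right hxlt.le hC0.le) hx₁C
    have hαz : 0 ≤ Ac z / 2 + pc z * Bc z := by
      have h := shell_alpha_nonneg (s := s) (t := t) hx hr0 hxs
      have heq : Ac z / 2 + pc z * Bc z =
          ((1 / 2) * (-2 * ((ρ - r z) ^ 3)⁻¹ - -((ρ - r z) ^ 2)⁻¹ / r z) +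
            -(s / (ρ - r z) ^ 2 + t / (ρ - r z)) * -((ρ - r z) ^ 2)⁻¹) / r z ^ 2 := by
        simp only [hAc, hBc, hpc, bdryPot₁, bdryPot₂, bdryWeight₁]
        field_simp
      rw [heq]
      exact div_nonneg h (sq_nonneg _)
    have hβz : δ / (ρ - r z) ^ 4 ≤
        Bc z / 2 + (Ac z * r z ^ 2 + Fintype.card ι * Bc z) / 4 + pc z * Bc z * r z ^ 2 / 2 := by
      have h := shell_beta_lower_bound (s := s) (t := t) (m := m) (ε := ε) hx
        (by linarith [hxlt.le, hx₁ρ]) (hSr z hz).1.le hxε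
      have heq : Bc z / 2 + (Ac z * r z ^ 2 + Fintype.card ι * Bc z) / 4 + pc z * Bc z * r z ^ 2 / 2 =
          (1 / 2) * (-((ρ - r z) ^ 2)⁻¹) / r z +
            (1 / 4) * (-2 * ((ρ - r z) ^ 3)⁻¹ + m * -((ρ - r z) ^ 2)⁻¹ / r z) +
            (1 / 2) * (-(s / (ρ - r z) ^ 2 + t / (ρ - r z)) * -((ρ - r z) ^ 2)⁻¹) := by
        simp only [hAc, hBc, hpc, bdryPot₁, bdryPot₂, bdryWeight₁, hm]
        field_simp
        ring
      rw [heq, hδ]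
      exact h
    rw [hTz z hz]
    have hW2 : 0 ≤ Wf z ^ 2 := sq_nonneg _
    have hQ0 : 0 ≤ Qf z := Finset.sum_nonneg fun i _ ↦ sq_nonneg _
    nlinarith [mul_nonneg hαz hW2, mul_le_mul_of_nonneg_right hβz hQ0]
  -- `Σ Vⱼ² = 1/x⁴` and the pointwise bound for the pairing
  have hQ0 : ∀ z, 0 ≤ Qf z := fun z ↦ Finset.sum_nonneg fun i _ ↦ sq_nonneg _
  have hMF0 : ∀ z, 0 ≤ MF z := fun z ↦
    Finset.sum_nonneg fun i _ ↦ Finset.sum_nonneg fun j _ ↦ sq_nonneg _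
  have hVsq : ∀ z ∈ S, ∑ j, V j z ^ 2 = 1 / (ρ - r z) ^ 4 := by
    intro z hz
    simp_rw [hVz z hz, mul_pow, ← Finset.mul_sum, hparse z]
    have h1 := hrS z hz
    have h2 := hxS z hz
    simp only [bdryPot₁]
    field_simp
  have hPup : ∀ z ∈ S, -Pf z ≤ δ * (Qf z / (ρ - r z) ^ 4) / 2 + MF z / (2 * δ) := by
    intro z hz
    have hx4 : 0 < (ρ - r z) ^ 4 := pow_pos (hSx z hz).1 4
    refine le_of_sq_le_mul hδ0 (div_nonneg (hQ0 z) hx4.le) (hMF0 z) ?_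
    rw [neg_sq]
    calc Pf z ^ 2 ≤ MF z * Qf z * ∑ j, V j z ^ 2 :=
          sq_sum_sum_mul_mul_le (fun i j ↦ Mf i j z) (fun i ↦ Y i z) (fun j ↦ V j z)
      _ = Qf z / (ρ - r z) ^ 4 * MF z := by rw [hVsq z hz]; ring
  -- continuity and vanishing off `K`
  have hY0 : ∀ j, Continuous (Y j) := fun j ↦ (hY j).continuous
  have hdY : ∀ j e, Continuous fun z ↦ fderiv ℝ (Y j) z e := fun j e ↦
    ((hY j).continuous_fderiv one_ne_zero).clm_apply continuous_const
  have hMfc : ∀ i j, Continuous (Mf i j) := fun i j ↦ by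
    simp only [hMf]
    exact (((hdY j _).add (hdY i _)).div_const _).add
      (continuous_if_const _ (fun _ ↦ continuous_finsetSum _ fun k _ ↦ (hdY k _).div_const _)
        (fun _ ↦ continuous_const))
  have hQfc : Continuous Qf := continuous_finsetSum _ fun i _ ↦ (hY0 i).pow 2
  have hMFc : Continuous MF :=
    continuous_finsetSum _ fun i _ ↦ continuous_finsetSum _ fun j _ ↦ (hMfc i j).pow 2
  have hMfK : ∀ z, z ∉ K → ∀ i j, Mf i j z = 0 := fun z hz i j ↦ by
    simp only [hMf, hdYK z hz, zero_div, zero_add, Finset.sum_const_zero, ite_self]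
  have hQfK : ∀ z, z ∉ K → Qf z = 0 := fun z hz ↦ by
    simp only [hQf, hYK z hz, ne_eq, OfNat.ofNat_ne_zero, not_false_eq_true, zero_pow,
      Finset.sum_const_zero]
  have hMFK : ∀ z, z ∉ K → MF z = 0 := fun z hz ↦ by
    simp only [hMF, hMfK z hz, ne_eq, OfNat.ofNat_ne_zero, not_false_eq_true, zero_pow,
      Finset.sum_const_zero]
  have hPfK : ∀ z, z ∉ K → Pf z = 0 := fun z hz ↦ by
    simp only [hPf, hYK z hz, mul_zero, zero_mul, Finset.sum_const_zero]
  have hTfK : ∀ z, z ∉ K → Tf z = 0 := fun z hz ↦ by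
    simp only [hTf, hYK z hz, mul_zero, zero_mul, zero_div, add_zero, ne_eq, OfNat.ofNat_ne_zero,
      not_false_eq_true, zero_pow, Finset.sum_const_zero]
  -- continuity on `S` of the radial quantities
  have he2S : ContinuousOn e2 S :=
    Real.continuous_exp.comp_continuousOn (continuousOn_const.mul huS.continuousOn)
  have hVcS : ∀ j, ContinuousOn (V j) S := fun j ↦ (hVS j).continuousOn
  have hdVcS : ∀ i j, ContinuousOn (fun z ↦ fderiv ℝ (V j) z (b i)) S := fun i j ↦
    ((hVS j).continuousOn_fderiv_of_isOpen hS le_rfl).clm_apply continuousOn_const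
  have hduS : ∀ i, ContinuousOn (fun z ↦ fderiv ℝ uz z (b i)) S := fun i ↦
    (huS.continuousOn_fderiv_of_isOpen hS le_rfl).clm_apply continuousOn_const
  have hx4S : ContinuousOn (fun z ↦ ((ρ - r z) ^ 4)⁻¹) S :=
    ((continuousOn_const.sub hrc.continuousOn).pow 4).inv₀ fun z hz ↦ pow_ne_zero 4 (hxS z hz)
  -- integrability
  have hI_Q : Integrable fun z ↦ Qf z * (e2 z * ((ρ - r z) ^ 4)⁻¹) :=
    integrable_mul_of_eq_zero_off hKc hS hKS hQfc hQfK (he2S.mul hx4S)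
  have hI_M : Integrable fun z ↦ MF z * e2 z :=
    integrable_mul_of_eq_zero_off hKc hS hKS hMFc hMFK he2S
  have hI_T : Integrable fun z ↦ e2 z * Tf z := by
    have h : (fun z ↦ e2 z * Tf z) = fun z ↦ ∑ i, ∑ j, Y i z * (e2 z *
        (fderiv ℝ (V j) z (b i) * Y j z / 2 + fderiv ℝ (V j) z (b j) * Y i z / 4 +
          fderiv ℝ uz z (b j) * V j z * Y i z / 2 +
          (fderiv ℝ uz z (b i) * Y j z * V j z + fderiv ℝ uz z (b j) * Y j z * V i z) / 2)) := by
      funext z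
      simp only [hTf, Finset.mul_sum]
      exact Finset.sum_congr rfl fun i _ ↦ Finset.sum_congr rfl fun j _ ↦ by ring
    rw [h]
    refine integrable_finsetSum _ fun i _ ↦ integrable_finsetSum _ fun j _ ↦
      integrable_mul_of_eq_zero_off hKc hS hKS (hY0 i) (fun z hz ↦ hYK z hz i) (he2S.mul ?_)
    exact ((((hdVcS i j).mul (hY0 j).continuousOn).div_const _).add
      (((hdVcS j j).mul (hY0 i).continuousOn).div_const _)).add
      ((((hduS j).mul (hVcS j)).mul (hY0 i).continuousOn).div_const _) |>.add
      (((((hduS i).mul (hY0 j).continuousOn).mul (hVcS j)).add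
        (((hduS j).mul (hY0 j).continuousOn).mul (hVcS i))).div_const _)
  have hI_P : Integrable fun z ↦ e2 z * Pf z := by
    have h : (fun z ↦ e2 z * Pf z) = fun z ↦ ∑ i, ∑ j, Y i z * (e2 z * (Mf i j z * V j z)) := by
      funext z
      simp only [hPf, Finset.mul_sum]
      exact Finset.sum_congr rfl fun i _ ↦ Finset.sum_congr rfl fun j _ ↦ by ring
    rw [h]
    exact integrable_finsetSum _ fun i _ ↦ integrable_finsetSum _ fun j _ ↦
      integrable_mul_of_eq_zero_off hKc hS hKS (hY0 i) (fun z hz ↦ hYK z hz i)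
        (he2S.mul ((hMfc i j).continuousOn.mul (hVcS j)))
  -- step 1: `δ ∫ e2 Q/x⁴ ≤ ∫ e2 T`
  have hstep1 : δ * ∫ z, Qf z * (e2 z * ((ρ - r z) ^ 4)⁻¹) ≤ ∫ z, e2 z * Tf z := by
    rw [← integral_const_mul]
    refine integral_mono (hI_Q.const_mul δ) hI_T fun z ↦ ?_
    by_cases hz : z ∈ K
    · have hzS := hKS hz
      have h := mul_le_mul_of_nonneg_left (hTlow z hzS) (Real.exp_pos (2 * uz z)).le
      have hx4 : (ρ - r z) ^ 4 ≠ 0 := pow_ne_zero 4 (hxS z hzS)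
      calc δ * (Qf z * (e2 z * ((ρ - r z) ^ 4)⁻¹)) = e2 z * (δ / (ρ - r z) ^ 4 * Qf z) := by
            simp only [he2]; field_simp
        _ ≤ e2 z * Tf z := h
    · simp [hQfK z hz, hTfK z hz]
  -- step 2: `∫ -(e2 P) ≤ (δ/2) ∫ e2 Q/x⁴ + (1/(2δ)) ∫ e2 MF`
  have hstep2 : ∫ z, -(e2 z * Pf z) ≤
      (δ / 2) * (∫ z, Qf z * (e2 z * ((ρ - r z) ^ 4)⁻¹)) + (1 / (2 * δ)) * ∫ z, MF z * e2 z := by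
    rw [← integral_const_mul, ← integral_const_mul, ← integral_add ((hI_Q.const_mul _))
      (hI_M.const_mul _)]
    refine integral_mono hI_P.neg ((hI_Q.const_mul _).add (hI_M.const_mul _)) fun z ↦ ?_
    by_cases hz : z ∈ K
    · have hzS := hKS hz
      have h := mul_le_mul_of_nonneg_left (hPup z hzS) (Real.exp_pos (2 * uz z)).le
      have hx4 : (ρ - r z) ^ 4 ≠ 0 := pow_ne_zero 4 (hxS z hzS)
      calc -(e2 z * Pf z) = e2 z * -Pf z := by ring
        _ ≤ e2 z * (δ * (Qf z / (ρ - r z) ^ 4) / 2 + MF z / (2 * δ)) := h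
        _ = δ / 2 * (Qf z * (e2 z * ((ρ - r z) ^ 4)⁻¹)) + 1 / (2 * δ) * (MF z * e2 z) := by
            simp only [he2]; field_simp
    · simp [hQfK z hz, hMFK z hz, hPfK z hz]
  -- step 3: combine with Prop. D.2
  have hT_eq : ∫ z, e2 z * Tf z = ∫ z, -(e2 z * Pf z) := by
    rw [integral_neg, hD2', neg_neg]
  set I : ℝ := ∫ z, Qf z * (e2 z * ((ρ - r z) ^ 4)⁻¹) with hI
  set J : ℝ := ∫ z, MF z * e2 z with hJ
  have hIJ : δ ^ 2 * I ≤ J := by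
    have h : δ * I ≤ δ / 2 * I + 1 / (2 * δ) * J := hstep1.trans (hT_eq ▸ hstep2)
    have h2 : δ / 2 * I ≤ 1 / (2 * δ) * J := by linarith
    have h3 : δ * (δ / 2 * I) ≤ δ * (1 / (2 * δ) * J) := mul_le_mul_of_nonneg_left h2 hδ0.le
    have h4 : δ * (1 / (2 * δ) * J) = J / 2 := by field_simp
    nlinarith
  -- step 4: identify the integrals
  have hI' : (∫ z, Real.exp (-2 * s / (ρ - ‖z - z₀‖)) * (ρ - ‖z - z₀‖) ^ (2 * t - 4) *
      ∑ i, Y i z ^ 2) = I := by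
    rw [hI]
    refine integral_congr_ae (Eventually.of_forall fun z ↦ ?_)
    by_cases hz : z ∈ K
    · have hzS := hKS hz
      have hx : 0 < ρ - ‖z - z₀‖ := (hSx z hzS).1
      have hlt : ‖z - z₀‖ < ρ := (hSr z hzS).2
      have hsplit : (ρ - ‖z - z₀‖) ^ (2 * t - 4) = (ρ - ‖z - z₀‖) ^ (2 * t) / (ρ - ‖z - z₀‖) ^ 4 := by
        rw [Real.rpow_sub hx, show (4 : ℝ) = ((4 : ℕ) : ℝ) by norm_num, Real.rpow_natCast]
      simp only [he2, huz, hQf, hr]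
      rw [exp_two_mul_bdryWeight (r := ‖z - z₀‖) hlt, hsplit]
      field_simp
    · have h1 := hQfK z hz
      simp only [hQf] at h1
      show Real.exp (-2 * s / (ρ - ‖z - z₀‖)) * (ρ - ‖z - z₀‖) ^ (2 * t - 4) * ∑ i, Y i z ^ 2 =
        Qf z * _
      rw [hQfK z hz, zero_mul, h1, mul_zero]
  have hJ' : (∫ z, Real.exp (-2 * s / (ρ - ‖z - z₀‖)) * (ρ - ‖z - z₀‖) ^ (2 * t) *
      ∑ i, ∑ j, ((fderiv ℝ (Y j) z (b i) + fderiv ℝ (Y i) z (b j)) / 2 +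
        (if i = j then ∑ k, fderiv ℝ (Y k) z (b k) / 2 else 0)) ^ 2) = J := by
    rw [hJ]
    refine integral_congr_ae (Eventually.of_forall fun z ↦ ?_)
    by_cases hz : z ∈ K
    · have hzS := hKS hz
      have hlt : ‖z - z₀‖ < ρ := (hSr z hzS).2
      simp only [he2, huz, hMF, hMf]
      rw [exp_two_mul_bdryWeight (r := ‖z - z₀‖) hlt]
      ring
    · have h1 := hMFK z hz
      simp only [hMF, hMf] at h1
      show Real.exp (-2 * s / (ρ - ‖z - z₀‖)) * (ρ - ‖z - z₀‖) ^ (2 * t) *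
          ∑ i, ∑ j, ((fderiv ℝ (Y j) z (b i) + fderiv ℝ (Y i) z (b j)) / 2 +
            (if i = j then ∑ k, fderiv ℝ (Y k) z (b k) / 2 else 0)) ^ 2 = MF z * _
      rw [hMFK z hz, zero_mul, h1, mul_zero]
  rw [hI', hJ']
  exact hIJ

end Assembly

end WeightedPoincare

end Literature.Analysis.PDE

end
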